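import Summits.CriticalPhenomena.PercolationContinuityZ3.Theorems.PercNearOneGluingNoHeavyLowerTailCubicThreePointBernsteinStep
import Mathlib.Tactic.Ring
import Mathlib.Tactic.Linarith
import Mathlib.Tactic.Positivity
import HarnessLib

/-!
# `NoHeavyLowerTail` (stmt-CriticalPhenomena-4575) — SHK3⁺ and AG⁺ are CLOSED under the two terminal operations (terminal–terminal edge, pendant move of a terminal)

Support file (prover prim-ineq-gen-5 gen 3, new-inequality factory; `--supports stmt-CriticalPhenomena-4575`).  Pure algebra over a
commutative ring / `ℝ`: no measure theory, no named facts, no sorries.  Same cell convention as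
`PercNearOneGluingNoHeavyLowerTailCubicThreePointBernsteinStep` (`CubicThreePointStep.F` = the homogeneous SHK3⁺ cubic):
`(q, u₁, u₂, u₃, t) = (P(a|b|c), P(ab|c), P(ac|b), P(bc|a), P(abc))`, `σ = q+u₁+u₂+u₃+t`.

WHAT.  Two operations on a weighted graph `G` with terminals `a, b, c` act AFFINELY on the three-point law `x`:
* `E_ab^l` — add an edge of probability `l` between the vertices carrying `a` and `b`:
  `x ↦ ((1−l)q, u₁ + l q, (1−l)u₂, (1−l)u₃, t + l(u₂+u₃))` (the new edge merges the blocks of `a` and `b` with probability `l`,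
  independently).  In the apex-edge language of `CubicThreePointStep.bernstein_expansion` this is the DEGENERATE apex edge `y = b`:
  transitions `(α₁, α₂, β₁, β₂, β₃) = (q, 0, 0, u₂, u₃)`.
* `T_a^l` — move the terminal `a` to a new pendant vertex joined to the old one by an edge of probability `1−l`:
  `x ↦ (q + l(u₁+u₂), (1−l)u₁, (1−l)u₂, u₃ + l t, (1−l)t)` (`= D ∘ E_bc^l ∘ D`, `D` = the swap `q ↔ t`).
THEOREM A (this file).  With `AG = q t − e₂(u)` (Gladkov's three-point strong Harris–Kleitman form, tree
`prodBernoulli_threePoint_strongHarris`), `F = (σ+t)·AG − e₃(u)` (SHK3⁺) and `Ξ = σ·AG − e₃(u)` (AG⁺ = SF3-G3, the conjectured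
sharpening `q t ≥ e₂ + e₃` of prim-lit-2 / prim-ineq-prove-2):
   `F(E_ab^l x)  = (1−l)·[F(x) + l·((u₂+u₃)·AG(x) + u₂u₃(σ + t − q + u₁)) + l²·(u₂+u₃+q)u₂u₃]`      (`F_edge_ab`)
   `F(T_a^l x)   = (1−l)·[(1−l)·F(x) + l·σ·(AG(x) + u₁u₂)]`                                       (`F_pendant_a`)
   `Ξ(E_ab^l x)  = (1−l)·[Ξ(x) + l·u₂u₃(σ − q + u₁) + l²·q u₂u₃]`,  `Ξ(T_a^l x) = (1−l)·[Ξ(x) + l·u₁u₂(σ − t + u₃) + l²·t u₁u₂]`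
   `AG(E_ab^l x) = (1−l)·[AG(x) + l·u₂u₃]`,                         `AG(T_a^l x) = (1−l)·[AG(x) + l·u₁u₂]`
`(q+t)·Hqt(E_ab^l x) = (1−l)·[Hqt·(q(1−l)+t+l(u₂+u₃)) + l·u₂u₃(u₁(t+u₂+u₃) + (q+t)(t+l(u₂+u₃)))]` (`Hqt_edge_ab`; dual for `T_a`)
so for nonnegative cells and `l ∈ [0,1]` the sets `{AG ≥ 0, F ≥ 0}`, `{Ξ ≥ 0}`, `{H_{q+t} ≥ 0}` (and `{AG ≥ 0}`) are INVARIANT under `E_ab^l`, `T_a^l`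
(and, `F, Ξ, AG` being symmetric in `u₁,u₂,u₃` up to relabelling the terminals, under all six operations).
COROLLARIES (paper, memo run/shared/lean/prim/prim-ineq-gen-5/FINDINGS-gen5-g3.md §G3-9).  (i) The Bernstein coefficients of the
apex-edge step are nonnegative whenever the apex edge joins two TERMINALS: `threeB₁(x; q,0,0,u₂,u₃) = 2F + c₁ ≥ 0`,
`threeB₂ = F + c₁ + c₂ ≥ 0` (`threeB_edge_ab_nonneg`) — the degenerate case `y = b` of (B1),(B2) of the bern4 programme.
(ii) SHK3⁺ (= 3PT-LB = Sahi `E₃ ≥ 0` on the pairwise separations) and AG⁺ hold for every 3-terminal graph obtainable from an edgeless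
(glued) network by repeatedly adding terminal–terminal edges and moving terminals to new pendant vertices ("E/T-constructible": all graphs
with at most one Steiner vertex, all trees, `K₄`, `C₄` with one Steiner vertex, …) — the percolation semantics of `E`/`T` is the one-edge
decomposition `law = (1−l)·law(G∖e) + l·law(G/e)` with `law(G/e) = J_ab·law(G∖e)` for an edge between terminals.
[cite: Gladkov2024StrongFKG, Cor. 4.2 (the quadratic form AG)]; [cite: GladkovZimin2024HK, §4 (one-coordinate decomposition)]
-/

namespace Summit.CriticalPhenomena.PercolationContinuityZ3.Theorems

namespace CubicThreePointTerminal

open CubicThreePointStep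

variable {R : Type*} [CommRing R]

/-- Gladkov's three-point strong Harris–Kleitman (Aas–Gladkov) form `AG = q t − (u₁u₂ + u₁u₃ + u₂u₃)` (≥ 0 on every realizable law:
tree `prodBernoulli_threePoint_strongHarris`). [cite: Gladkov2024StrongFKG, Cor. 4.2] -/
def AG (q u₁ u₂ u₃ t : R) : R := q * t - (u₁ * u₂ + u₁ * u₃ + u₂ * u₃)

/-- The homogeneous AG⁺ cubic `Ξ = σ·(q t − e₂(u)) − e₃(u)`, `σ = q+u₁+u₂+u₃+t` (conjectured ≥ 0: `q t ≥ e₂ + e₃`; AG⁺ ⇒ SHK3⁺ since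
`F = Ξ + t·AG`). [cite: Gladkov2024StrongFKG, Cor. 4.2 (quadratic part)] -/
def Xi (q u₁ u₂ u₃ t : R) : R :=
  (q + u₁ + u₂ + u₃ + t) * (q * t - (u₁ * u₂ + u₁ * u₃ + u₂ * u₃)) - u₁ * u₂ * u₃

/-! ### Identities (any commutative ring) -/

/-- `AG` under the terminal–terminal edge `E_ab^l`: `AG(E_ab^l x) = (1−l)(AG(x) + l·u₂u₃)`. [folklore] -/
theorem AG_edge_ab (q u₁ u₂ u₃ t l : R) :
    AG ((1 - l) * q) (u₁ + l * q) ((1 - l) * u₂) ((1 - l) * u₃) (t + l * (u₂ + u₃)) =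
      (1 - l) * (AG q u₁ u₂ u₃ t + l * (u₂ * u₃)) := by
  simp only [AG]; ring

/-- `AG` under the pendant move `T_a^l`: `AG(T_a^l x) = (1−l)(AG(x) + l·u₁u₂)`. [folklore] -/
theorem AG_pendant_a (q u₁ u₂ u₃ t l : R) :
    AG (q + l * (u₁ + u₂)) ((1 - l) * u₁) ((1 - l) * u₂) (u₃ + l * t) ((1 - l) * t) =
      (1 - l) * (AG q u₁ u₂ u₃ t + l * (u₁ * u₂)) := by
  simp only [AG]; ring

/-- SHK3⁺ under `E_ab^l`:
`F(E_ab^l x) = (1−l)·[F + l·((u₂+u₃)AG + u₂u₃(σ + t − q + u₁)) + l²·(u₂+u₃+q)u₂u₃]`. [folklore] -/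
theorem F_edge_ab (q u₁ u₂ u₃ t l : R) :
    F ((1 - l) * q) (u₁ + l * q) ((1 - l) * u₂) ((1 - l) * u₃) (t + l * (u₂ + u₃)) =
      (1 - l) * (F q u₁ u₂ u₃ t
        + l * ((u₂ + u₃) * AG q u₁ u₂ u₃ t + u₂ * u₃ * ((q + u₁ + u₂ + u₃ + t) + t - q + u₁))
        + l * l * ((u₂ + u₃ + q) * (u₂ * u₃))) := by
  simp only [F, AG]; ring

/-- SHK3⁺ under `T_a^l`: the bracket is LINEAR in `l`:
`F(T_a^l x) = (1−l)·[(1−l)·F + l·σ·(AG + u₁u₂)]`. [folklore] -/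
theorem F_pendant_a (q u₁ u₂ u₃ t l : R) :
    F (q + l * (u₁ + u₂)) ((1 - l) * u₁) ((1 - l) * u₂) (u₃ + l * t) ((1 - l) * t) =
      (1 - l) * ((1 - l) * F q u₁ u₂ u₃ t + l * ((q + u₁ + u₂ + u₃ + t) * (AG q u₁ u₂ u₃ t + u₁ * u₂))) := by
  simp only [F, AG]; ring

/-- AG⁺ under `E_ab^l`: `Ξ(E_ab^l x) = (1−l)·[Ξ + l·u₂u₃(σ − q + u₁) + l²·q u₂u₃]`. [folklore] -/
theorem Xi_edge_ab (q u₁ u₂ u₃ t l : R) :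
    Xi ((1 - l) * q) (u₁ + l * q) ((1 - l) * u₂) ((1 - l) * u₃) (t + l * (u₂ + u₃)) =
      (1 - l) * (Xi q u₁ u₂ u₃ t + l * (u₂ * u₃ * ((q + u₁ + u₂ + u₃ + t) - q + u₁)) + l * l * (q * (u₂ * u₃))) := by
  simp only [Xi]; ring

/-- AG⁺ under `T_a^l`: `Ξ(T_a^l x) = (1−l)·[Ξ + l·u₁u₂(σ − t + u₃) + l²·t u₁u₂]`. [folklore] -/
theorem Xi_pendant_a (q u₁ u₂ u₃ t l : R) :
    Xi (q + l * (u₁ + u₂)) ((1 - l) * u₁) ((1 - l) * u₂) (u₃ + l * t) ((1 - l) * t) =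
      (1 - l) * (Xi q u₁ u₂ u₃ t + l * (u₁ * u₂ * ((q + u₁ + u₂ + u₃ + t) - t + u₃)) + l * l * (t * (u₁ * u₂))) := by
  simp only [Xi]; ring

/-- The apex-edge Bernstein coefficients at the DEGENERATE apex edge `y = b` (transitions `(q,0,0,u₂,u₃)`):
`threeB₁ = 2F + (u₂+u₃)AG + u₂u₃(σ+t−q+u₁)`. [folklore] -/
theorem threeB₁_edge_ab (q u₁ u₂ u₃ t : R) :
    threeB₁ q u₁ u₂ u₃ t q 0 0 u₂ u₃ =
      2 * F q u₁ u₂ u₃ t + ((u₂ + u₃) * AG q u₁ u₂ u₃ t + u₂ * u₃ * ((q + u₁ + u₂ + u₃ + t) + t - q + u₁)) := by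
  simp only [threeB₁, F, AG]; ring

/-- … and `threeB₂ = F + (u₂+u₃)AG + u₂u₃(σ+t−q+u₁) + (u₂+u₃+q)u₂u₃`. [folklore] -/
theorem threeB₂_edge_ab (q u₁ u₂ u₃ t : R) :
    threeB₂ q u₁ u₂ u₃ t q 0 0 u₂ u₃ =
      F q u₁ u₂ u₃ t + ((u₂ + u₃) * AG q u₁ u₂ u₃ t + u₂ * u₃ * ((q + u₁ + u₂ + u₃ + t) + t - q + u₁))
        + (u₂ + u₃ + q) * (u₂ * u₃) := by
  simp only [threeB₂, F, AG]; ring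

/-! ### Invariance (over `ℝ`) -/

/-- `{AG ≥ 0}` is invariant under the terminal–terminal edge. [folklore] -/
theorem AG_edge_ab_nonneg {q u₁ u₂ u₃ t l : ℝ} (hu₂ : 0 ≤ u₂) (hu₃ : 0 ≤ u₃) (hl₀ : 0 ≤ l) (hl₁ : l ≤ 1)
    (hag : 0 ≤ AG q u₁ u₂ u₃ t) :
    0 ≤ AG ((1 - l) * q) (u₁ + l * q) ((1 - l) * u₂) ((1 - l) * u₃) (t + l * (u₂ + u₃)) := by
  rw [AG_edge_ab]
  have hm : 0 ≤ 1 - l := by linarith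
  exact mul_nonneg hm (add_nonneg hag (mul_nonneg hl₀ (mul_nonneg hu₂ hu₃)))

/-- `{AG ≥ 0}` is invariant under the pendant move. [folklore] -/
theorem AG_pendant_a_nonneg {q u₁ u₂ u₃ t l : ℝ} (hu₁ : 0 ≤ u₁) (hu₂ : 0 ≤ u₂) (hl₀ : 0 ≤ l) (hl₁ : l ≤ 1)
    (hag : 0 ≤ AG q u₁ u₂ u₃ t) :
    0 ≤ AG (q + l * (u₁ + u₂)) ((1 - l) * u₁) ((1 - l) * u₂) (u₃ + l * t) ((1 - l) * t) := by
  rw [AG_pendant_a]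
  have hm : 0 ≤ 1 - l := by linarith
  exact mul_nonneg hm (add_nonneg hag (mul_nonneg hl₀ (mul_nonneg hu₁ hu₂)))

/-- **THEOREM A (edge).**  `{AG ≥ 0, SHK3⁺ ≥ 0}` is invariant under adding a terminal–terminal edge of any probability `l ∈ [0,1]`
(cells nonnegative, `q ≤ σ` automatic). [folklore] -/
theorem F_edge_ab_nonneg {q u₁ u₂ u₃ t l : ℝ} (hq : 0 ≤ q) (hu₁ : 0 ≤ u₁) (hu₂ : 0 ≤ u₂) (hu₃ : 0 ≤ u₃) (ht : 0 ≤ t)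
    (hl₀ : 0 ≤ l) (hl₁ : l ≤ 1) (hag : 0 ≤ AG q u₁ u₂ u₃ t) (hF : 0 ≤ F q u₁ u₂ u₃ t) :
    0 ≤ F ((1 - l) * q) (u₁ + l * q) ((1 - l) * u₂) ((1 - l) * u₃) (t + l * (u₂ + u₃)) := by
  rw [F_edge_ab]
  have hm : 0 ≤ 1 - l := by linarith
  have hs : 0 ≤ (q + u₁ + u₂ + u₃ + t) + t - q + u₁ := by linarith
  have h1 : 0 ≤ (u₂ + u₃) * AG q u₁ u₂ u₃ t + u₂ * u₃ * ((q + u₁ + u₂ + u₃ + t) + t - q + u₁) :=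
    add_nonneg (mul_nonneg (add_nonneg hu₂ hu₃) hag) (mul_nonneg (mul_nonneg hu₂ hu₃) hs)
  have h2 : 0 ≤ (u₂ + u₃ + q) * (u₂ * u₃) := mul_nonneg (by linarith) (mul_nonneg hu₂ hu₃)
  exact mul_nonneg hm (add_nonneg (add_nonneg hF (mul_nonneg hl₀ h1)) (mul_nonneg (mul_nonneg hl₀ hl₀) h2))

/-- **THEOREM A (pendant).**  `{AG ≥ 0, SHK3⁺ ≥ 0}` is invariant under moving a terminal to a new pendant vertex. [folklore] -/
theorem F_pendant_a_nonneg {q u₁ u₂ u₃ t l : ℝ} (hq : 0 ≤ q) (hu₁ : 0 ≤ u₁) (hu₂ : 0 ≤ u₂) (hu₃ : 0 ≤ u₃) (ht : 0 ≤ t)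
    (hl₀ : 0 ≤ l) (hl₁ : l ≤ 1) (hag : 0 ≤ AG q u₁ u₂ u₃ t) (hF : 0 ≤ F q u₁ u₂ u₃ t) :
    0 ≤ F (q + l * (u₁ + u₂)) ((1 - l) * u₁) ((1 - l) * u₂) (u₃ + l * t) ((1 - l) * t) := by
  rw [F_pendant_a]
  have hm : 0 ≤ 1 - l := by linarith
  have hσ : 0 ≤ q + u₁ + u₂ + u₃ + t := by linarith
  exact mul_nonneg hm (add_nonneg (mul_nonneg hm hF) (mul_nonneg hl₀ (mul_nonneg hσ (add_nonneg hag (mul_nonneg hu₁ hu₂)))))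

/-- **THEOREM A (AG⁺, edge).**  `{Ξ ≥ 0}` is invariant under the terminal–terminal edge. [folklore] -/
theorem Xi_edge_ab_nonneg {q u₁ u₂ u₃ t l : ℝ} (hq : 0 ≤ q) (hu₁ : 0 ≤ u₁) (hu₂ : 0 ≤ u₂) (hu₃ : 0 ≤ u₃) (ht : 0 ≤ t)
    (hl₀ : 0 ≤ l) (hl₁ : l ≤ 1) (hXi : 0 ≤ Xi q u₁ u₂ u₃ t) :
    0 ≤ Xi ((1 - l) * q) (u₁ + l * q) ((1 - l) * u₂) ((1 - l) * u₃) (t + l * (u₂ + u₃)) := by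
  rw [Xi_edge_ab]
  have hm : 0 ≤ 1 - l := by linarith
  have hs : 0 ≤ (q + u₁ + u₂ + u₃ + t) - q + u₁ := by linarith
  exact mul_nonneg hm (add_nonneg (add_nonneg hXi (mul_nonneg hl₀ (mul_nonneg (mul_nonneg hu₂ hu₃) hs)))
    (mul_nonneg (mul_nonneg hl₀ hl₀) (mul_nonneg hq (mul_nonneg hu₂ hu₃))))

/-- **THEOREM A (AG⁺, pendant).**  `{Ξ ≥ 0}` is invariant under the pendant move. [folklore] -/
theorem Xi_pendant_a_nonneg {q u₁ u₂ u₃ t l : ℝ} (hq : 0 ≤ q) (hu₁ : 0 ≤ u₁) (hu₂ : 0 ≤ u₂) (hu₃ : 0 ≤ u₃) (ht : 0 ≤ t)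
    (hl₀ : 0 ≤ l) (hl₁ : l ≤ 1) (hXi : 0 ≤ Xi q u₁ u₂ u₃ t) :
    0 ≤ Xi (q + l * (u₁ + u₂)) ((1 - l) * u₁) ((1 - l) * u₂) (u₃ + l * t) ((1 - l) * t) := by
  rw [Xi_pendant_a]
  have hm : 0 ≤ 1 - l := by linarith
  have hs : 0 ≤ (q + u₁ + u₂ + u₃ + t) - t + u₃ := by linarith
  exact mul_nonneg hm (add_nonneg (add_nonneg hXi (mul_nonneg hl₀ (mul_nonneg (mul_nonneg hu₁ hu₂) hs)))
    (mul_nonneg (mul_nonneg hl₀ hl₀) (mul_nonneg ht (mul_nonneg hu₁ hu₂))))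

/-- **(B1),(B2) for an apex edge joining two terminals.**  The two Bernstein coefficients of the bern4 programme are nonnegative in the
degenerate case `y = b` (transitions `(q,0,0,u₂,u₃)`), given `AG ≥ 0` and `F ≥ 0` at `x⁰`. [folklore] -/
theorem threeB_edge_ab_nonneg {q u₁ u₂ u₃ t : ℝ} (hq : 0 ≤ q) (hu₁ : 0 ≤ u₁) (hu₂ : 0 ≤ u₂) (hu₃ : 0 ≤ u₃) (ht : 0 ≤ t)
    (hag : 0 ≤ AG q u₁ u₂ u₃ t) (hF : 0 ≤ F q u₁ u₂ u₃ t) :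
    0 ≤ threeB₁ q u₁ u₂ u₃ t q 0 0 u₂ u₃ ∧ 0 ≤ threeB₂ q u₁ u₂ u₃ t q 0 0 u₂ u₃ := by
  rw [threeB₁_edge_ab, threeB₂_edge_ab]
  have hs : 0 ≤ (q + u₁ + u₂ + u₃ + t) + t - q + u₁ := by linarith
  have h1 : 0 ≤ (u₂ + u₃) * AG q u₁ u₂ u₃ t + u₂ * u₃ * ((q + u₁ + u₂ + u₃ + t) + t - q + u₁) :=
    add_nonneg (mul_nonneg (add_nonneg hu₂ hu₃) hag) (mul_nonneg (mul_nonneg hu₂ hu₃) hs)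
  have h2 : 0 ≤ (u₂ + u₃ + q) * (u₂ * u₃) := mul_nonneg (by linarith) (mul_nonneg hu₂ hu₃)
  constructor
  · linarith
  · linarith

/-! ### H_{q+t} = (q+t)·AG − e₃ (prim-lit-2 §17.8; between AG⁺ and SF3-Hmax): also closed under both terminal operations -/

/-- The homogeneous cubic `H_{q+t} = (q+t)(q t − e₂(u)) − e₃(u)` (conjectured ≥ 0 on realizable laws; `Hmax ⇒ H_{q+t} ⇒ AG⁺ ⇒ SHK3⁺`).
[cite: Gladkov2024StrongFKG, Cor. 4.2 (quadratic part)] -/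
def Hqt (q u₁ u₂ u₃ t : R) : R := (q + t) * (q * t - (u₁ * u₂ + u₁ * u₃ + u₂ * u₃)) - u₁ * u₂ * u₃

/-- `H_{q+t}` under `E_ab^l`, multiplied by `q + t`:
`(q+t)·Hqt(E_ab^l x) = (1−l)·[Hqt·(q(1−l) + t + l(u₂+u₃)) + l·u₂u₃·(u₁(t+u₂+u₃) + (q+t)(t + l(u₂+u₃)))]`. [folklore] -/
theorem Hqt_edge_ab (q u₁ u₂ u₃ t l : R) :
    (q + t) * Hqt ((1 - l) * q) (u₁ + l * q) ((1 - l) * u₂) ((1 - l) * u₃) (t + l * (u₂ + u₃)) =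
      (1 - l) * (Hqt q u₁ u₂ u₃ t * (q * (1 - l) + t + l * (u₂ + u₃))
        + l * (u₂ * u₃) * (u₁ * (t + (u₂ + u₃)) + (q + t) * (t + l * (u₂ + u₃)))) := by
  simp only [Hqt]; ring

/-- `H_{q+t}` under `T_a^l`, multiplied by `q + t` (dual form). [folklore] -/
theorem Hqt_pendant_a (q u₁ u₂ u₃ t l : R) :
    (q + t) * Hqt (q + l * (u₁ + u₂)) ((1 - l) * u₁) ((1 - l) * u₂) (u₃ + l * t) ((1 - l) * t) =
      (1 - l) * (Hqt q u₁ u₂ u₃ t * (t * (1 - l) + q + l * (u₁ + u₂))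
        + l * (u₁ * u₂) * (u₃ * (q + (u₁ + u₂)) + (q + t) * (q + l * (u₁ + u₂)))) := by
  simp only [Hqt]; ring

/-- **THEOREM A (H_{q+t}, edge).**  `{H_{q+t} ≥ 0}` is invariant under the terminal–terminal edge (cells ≥ 0, `q + t > 0`;
no `AG` hypothesis needed). [folklore] -/
theorem Hqt_edge_ab_nonneg {q u₁ u₂ u₃ t l : ℝ} (hq : 0 ≤ q) (hu₁ : 0 ≤ u₁) (hu₂ : 0 ≤ u₂) (hu₃ : 0 ≤ u₃) (ht : 0 ≤ t)
    (hqt : 0 < q + t) (hl₀ : 0 ≤ l) (hl₁ : l ≤ 1) (hH : 0 ≤ Hqt q u₁ u₂ u₃ t) :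
    0 ≤ Hqt ((1 - l) * q) (u₁ + l * q) ((1 - l) * u₂) ((1 - l) * u₃) (t + l * (u₂ + u₃)) := by
  have hm : 0 ≤ 1 - l := by linarith
  have h1 : 0 ≤ q * (1 - l) + t + l * (u₂ + u₃) :=
    add_nonneg (add_nonneg (mul_nonneg hq hm) ht) (mul_nonneg hl₀ (add_nonneg hu₂ hu₃))
  have h2 : 0 ≤ u₁ * (t + (u₂ + u₃)) + (q + t) * (t + l * (u₂ + u₃)) :=
    add_nonneg (mul_nonneg hu₁ (add_nonneg ht (add_nonneg hu₂ hu₃)))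
      (mul_nonneg hqt.le (add_nonneg ht (mul_nonneg hl₀ (add_nonneg hu₂ hu₃))))
  have key : 0 ≤ (q + t) * Hqt ((1 - l) * q) (u₁ + l * q) ((1 - l) * u₂) ((1 - l) * u₃) (t + l * (u₂ + u₃)) := by
    rw [Hqt_edge_ab]
    exact mul_nonneg hm (add_nonneg (mul_nonneg hH h1) (mul_nonneg (mul_nonneg hl₀ (mul_nonneg hu₂ hu₃)) h2))
  by_contra hneg
  have : (q + t) * Hqt ((1 - l) * q) (u₁ + l * q) ((1 - l) * u₂) ((1 - l) * u₃) (t + l * (u₂ + u₃)) < 0 :=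
    mul_neg_of_pos_of_neg hqt (not_le.mp hneg)
  linarith

/-- **THEOREM A (H_{q+t}, pendant).**  `{H_{q+t} ≥ 0}` is invariant under the pendant move (cells ≥ 0, `q + t > 0`). [folklore] -/
theorem Hqt_pendant_a_nonneg {q u₁ u₂ u₃ t l : ℝ} (hq : 0 ≤ q) (hu₁ : 0 ≤ u₁) (hu₂ : 0 ≤ u₂) (hu₃ : 0 ≤ u₃) (ht : 0 ≤ t)
    (hqt : 0 < q + t) (hl₀ : 0 ≤ l) (hl₁ : l ≤ 1) (hH : 0 ≤ Hqt q u₁ u₂ u₃ t) :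
    0 ≤ Hqt (q + l * (u₁ + u₂)) ((1 - l) * u₁) ((1 - l) * u₂) (u₃ + l * t) ((1 - l) * t) := by
  have hm : 0 ≤ 1 - l := by linarith
  have h1 : 0 ≤ t * (1 - l) + q + l * (u₁ + u₂) :=
    add_nonneg (add_nonneg (mul_nonneg ht hm) hq) (mul_nonneg hl₀ (add_nonneg hu₁ hu₂))
  have h2 : 0 ≤ u₃ * (q + (u₁ + u₂)) + (q + t) * (q + l * (u₁ + u₂)) :=
    add_nonneg (mul_nonneg hu₃ (add_nonneg hq (add_nonneg hu₁ hu₂)))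
      (mul_nonneg hqt.le (add_nonneg hq (mul_nonneg hl₀ (add_nonneg hu₁ hu₂))))
  have key : 0 ≤ (q + t) * Hqt (q + l * (u₁ + u₂)) ((1 - l) * u₁) ((1 - l) * u₂) (u₃ + l * t) ((1 - l) * t) := by
    rw [Hqt_pendant_a]
    exact mul_nonneg hm (add_nonneg (mul_nonneg hH h1) (mul_nonneg (mul_nonneg hl₀ (mul_nonneg hu₁ hu₂)) h2))
  by_contra hneg
  have : (q + t) * Hqt (q + l * (u₁ + u₂)) ((1 - l) * u₁) ((1 - l) * u₂) (u₃ + l * t) ((1 - l) * t) < 0 :=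
    mul_neg_of_pos_of_neg hqt (not_le.mp hneg)
  linarith

/-! ### SF3-Hmax (prim-lit-2 §16.6): `max(q,t)·AG ≥ e₃`, i.e. `Ha ≥ 0 ∨ Hb ≥ 0` with `Ha = t·AG − e₃`, `Hb = q·AG − e₃` — also closed -/

/-- The star-sheet form `Ha = t²σ − (t+u₁)(t+u₂)(t+u₃) = t·AG − e₃` (vanishes on every star `K_{1,3}`; `Ha ≥ 0 ⇔ P(abc)² ≥ P(ab)P(ac)P(bc)`,
conjectured whenever `P(abc) ≥ P(a|b|c)`). [cite: Gladkov2024StrongFKG, Cor. 4.2 (quadratic part)] -/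
def Ha (q u₁ u₂ u₃ t : R) : R := t * (q * t - (u₁ * u₂ + u₁ * u₃ + u₂ * u₃)) - u₁ * u₂ * u₃

/-- The triangle-sheet form `Hb = q²σ − (q+u₁)(q+u₂)(q+u₃) = q·AG − e₃` (vanishes on every triangle; conjectured ≥ 0 whenever
`P(a|b|c) ≥ P(abc)`). [cite: Gladkov2024StrongFKG, Cor. 4.2 (quadratic part)] -/
def Hb (q u₁ u₂ u₃ t : R) : R := q * (q * t - (u₁ * u₂ + u₁ * u₃ + u₂ * u₃)) - u₁ * u₂ * u₃

/-- `Hb` SCALES under the terminal–terminal edge: `Hb(E_ab^l x) = (1−l)²·Hb(x)`. [folklore] -/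
theorem Hb_edge_ab (q u₁ u₂ u₃ t l : R) :
    Hb ((1 - l) * q) (u₁ + l * q) ((1 - l) * u₂) ((1 - l) * u₃) (t + l * (u₂ + u₃)) = (1 - l) ^ 2 * Hb q u₁ u₂ u₃ t := by
  simp only [Hb]; ring

/-- `Ha` under the terminal–terminal edge: `Ha(E_ab^l x) = (1−l)·[Ha + l·((u₂+u₃)AG + u₂u₃(t − q + u₁)) + l²·(u₂+u₃+q)u₂u₃]`. [folklore] -/
theorem Ha_edge_ab (q u₁ u₂ u₃ t l : R) :
    Ha ((1 - l) * q) (u₁ + l * q) ((1 - l) * u₂) ((1 - l) * u₃) (t + l * (u₂ + u₃)) =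
      (1 - l) * (Ha q u₁ u₂ u₃ t + l * ((u₂ + u₃) * AG q u₁ u₂ u₃ t + u₂ * u₃ * (t - q + u₁)) + l * l * ((u₂ + u₃ + q) * (u₂ * u₃))) := by
  simp only [Ha, AG]; ring

/-- `Ha` SCALES under the pendant move: `Ha(T_a^l x) = (1−l)²·Ha(x)` (dual of `Hb_edge_ab`). [folklore] -/
theorem Ha_pendant_a (q u₁ u₂ u₃ t l : R) :
    Ha (q + l * (u₁ + u₂)) ((1 - l) * u₁) ((1 - l) * u₂) (u₃ + l * t) ((1 - l) * t) = (1 - l) ^ 2 * Ha q u₁ u₂ u₃ t := by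
  simp only [Ha]; ring

/-- `Hb` under the pendant move: `Hb(T_a^l x) = (1−l)·[Hb + l·((u₁+u₂)AG + u₁u₂(q − t + u₃)) + l²·(u₁+u₂+t)u₁u₂]`. [folklore] -/
theorem Hb_pendant_a (q u₁ u₂ u₃ t l : R) :
    Hb (q + l * (u₁ + u₂)) ((1 - l) * u₁) ((1 - l) * u₂) (u₃ + l * t) ((1 - l) * t) =
      (1 - l) * (Hb q u₁ u₂ u₃ t + l * ((u₁ + u₂) * AG q u₁ u₂ u₃ t + u₁ * u₂ * (q - t + u₃)) + l * l * ((u₁ + u₂ + t) * (u₁ * u₂))) := by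
  simp only [Hb, AG]; ring

/-- `Ha − Hb = (t − q)·AG`: given `AG ≥ 0`, `Hmax = max(Ha, Hb)` is `Ha` in the regime `t ≥ q` and `Hb` in the regime `q ≥ t`. [folklore] -/
theorem Ha_sub_Hb (q u₁ u₂ u₃ t : R) : Ha q u₁ u₂ u₃ t - Hb q u₁ u₂ u₃ t = (t - q) * AG q u₁ u₂ u₃ t := by
  simp only [Ha, Hb, AG]; ring

/-- **THEOREM A (SF3-Hmax, edge).**  `{AG ≥ 0, Ha ≥ 0 ∨ Hb ≥ 0}` is invariant under adding a terminal–terminal edge: if `Hb ≥ 0` it scales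
by `(1−l)²`; if `Ha ≥ 0 > Hb` then `t ≥ q` and every coefficient of the `Ha`-bracket is nonnegative. [folklore] -/
theorem Hmax_edge_ab_nonneg {q u₁ u₂ u₃ t l : ℝ} (hq : 0 ≤ q) (hu₁ : 0 ≤ u₁) (hu₂ : 0 ≤ u₂) (hu₃ : 0 ≤ u₃)
    (hl₀ : 0 ≤ l) (hl₁ : l ≤ 1) (hag : 0 ≤ AG q u₁ u₂ u₃ t) (h : 0 ≤ Ha q u₁ u₂ u₃ t ∨ 0 ≤ Hb q u₁ u₂ u₃ t) :
    0 ≤ Ha ((1 - l) * q) (u₁ + l * q) ((1 - l) * u₂) ((1 - l) * u₃) (t + l * (u₂ + u₃)) ∨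
      0 ≤ Hb ((1 - l) * q) (u₁ + l * q) ((1 - l) * u₂) ((1 - l) * u₃) (t + l * (u₂ + u₃)) := by
  have hm : 0 ≤ 1 - l := by linarith
  by_cases hb : 0 ≤ Hb q u₁ u₂ u₃ t
  · right
    rw [Hb_edge_ab]
    exact mul_nonneg (pow_nonneg hm 2) hb
  · left
    have hb' : Hb q u₁ u₂ u₃ t < 0 := not_le.mp hb
    have ha : 0 ≤ Ha q u₁ u₂ u₃ t := by
      rcases h with h | h
      · exact h
      · exact absurd h hb
    have hdiff := Ha_sub_Hb q u₁ u₂ u₃ t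
    have htq : 0 ≤ t - q := by
      by_contra hc
      have hc' : t - q < 0 := not_le.mp hc
      have : (t - q) * AG q u₁ u₂ u₃ t ≤ 0 := mul_nonpos_of_nonpos_of_nonneg hc'.le hag
      linarith
    rw [Ha_edge_ab]
    have hs : 0 ≤ t - q + u₁ := by linarith
    have h1 : 0 ≤ (u₂ + u₃) * AG q u₁ u₂ u₃ t + u₂ * u₃ * (t - q + u₁) :=
      add_nonneg (mul_nonneg (add_nonneg hu₂ hu₃) hag) (mul_nonneg (mul_nonneg hu₂ hu₃) hs)
    have h2 : 0 ≤ (u₂ + u₃ + q) * (u₂ * u₃) := mul_nonneg (by linarith) (mul_nonneg hu₂ hu₃)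
    exact mul_nonneg hm (add_nonneg (add_nonneg ha (mul_nonneg hl₀ h1)) (mul_nonneg (mul_nonneg hl₀ hl₀) h2))

/-- **THEOREM A (SF3-Hmax, pendant).**  `{AG ≥ 0, Ha ≥ 0 ∨ Hb ≥ 0}` is invariant under the pendant move of a terminal (dual case analysis).
[folklore] -/
theorem Hmax_pendant_a_nonneg {q u₁ u₂ u₃ t l : ℝ} (hu₁ : 0 ≤ u₁) (hu₂ : 0 ≤ u₂) (hu₃ : 0 ≤ u₃) (ht : 0 ≤ t)
    (hl₀ : 0 ≤ l) (hl₁ : l ≤ 1) (hag : 0 ≤ AG q u₁ u₂ u₃ t) (h : 0 ≤ Ha q u₁ u₂ u₃ t ∨ 0 ≤ Hb q u₁ u₂ u₃ t) :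
    0 ≤ Ha (q + l * (u₁ + u₂)) ((1 - l) * u₁) ((1 - l) * u₂) (u₃ + l * t) ((1 - l) * t) ∨
      0 ≤ Hb (q + l * (u₁ + u₂)) ((1 - l) * u₁) ((1 - l) * u₂) (u₃ + l * t) ((1 - l) * t) := by
  have hm : 0 ≤ 1 - l := by linarith
  by_cases ha : 0 ≤ Ha q u₁ u₂ u₃ t
  · left
    rw [Ha_pendant_a]
    exact mul_nonneg (pow_nonneg hm 2) ha
  · right
    have ha' : Ha q u₁ u₂ u₃ t < 0 := not_le.mp ha
    have hb : 0 ≤ Hb q u₁ u₂ u₃ t := by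
      rcases h with h | h
      · exact absurd h ha
      · exact h
    have hdiff := Ha_sub_Hb q u₁ u₂ u₃ t
    have hqt : 0 ≤ q - t := by
      by_contra hc
      have hc' : q - t < 0 := not_le.mp hc
      have : 0 ≤ (t - q) * AG q u₁ u₂ u₃ t := mul_nonneg (by linarith) hag
      linarith
    rw [Hb_pendant_a]
    have hs : 0 ≤ q - t + u₃ := by linarith
    have h1 : 0 ≤ (u₁ + u₂) * AG q u₁ u₂ u₃ t + u₁ * u₂ * (q - t + u₃) :=
      add_nonneg (mul_nonneg (add_nonneg hu₁ hu₂) hag) (mul_nonneg (mul_nonneg hu₁ hu₂) hs)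
    have h2 : 0 ≤ (u₁ + u₂ + t) * (u₁ * u₂) := mul_nonneg (by linarith) (mul_nonneg hu₁ hu₂)
    exact mul_nonneg hm (add_nonneg (add_nonneg hb (mul_nonneg hl₀ h1)) (mul_nonneg (mul_nonneg hl₀ hl₀) h2))

end CubicThreePointTerminal

end Summit.CriticalPhenomena.PercolationContinuityZ3.Theorems
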